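import Mathlib
import HarnessLib
import Summits.ValiantsHypothesis.ValiantsHypothesis.Statement
import Summits.ValiantsHypothesis.ValiantsHypothesis.Theses.GirthSidon
import Summits.ValiantsHypothesis.ValiantsHypothesis.Theorems.GirthSidonMomentExponentsRelationFree
import Summits.ValiantsHypothesis.ValiantsHypothesis.Theorems.GirthSidonMomentCurveElusiveCoveringGirth
import Summits.ValiantsHypothesis.ValiantsHypothesis.Theorems.GirthSidonMomentCurveElusiveMonomialNumericToPuiseux

/-!
# Birth skeleton (BC3) — crux `MomentCurveElusive` (item `stmt-ValiantsHypothesis-6534`,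
route `GirthSidon`, rank 0: the route's X, the only open leaf of `closes`)

Line: **TRANSFER → SMALL SUMSET COVER → GIRTH → VANDERMONDE.** The crux says that for large `m`
and every `s` with `s^10 ≤ m^9` the power-sum moment curve `x ↦ (x^{d(m,i)})_{i<m}`,
`d(m,i) = Σ_{k<60} (i+1)^k m^{60k}`, is `(s,2)`-elusive (Raz). The skeleton separates

* `stub_monomialNumericToPuiseux` (provable now, S–M; numeric-to-formal transfer for MONOMIAL
  curves): if `x ↦ (x^{d_i})_i` is NOT `(s,2)`-elusive then some quadratic `Γ : ℂ^s → ℂ^m` swallows it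
  FORMALLY along Laurent series after a ramification `x = t^N`: `Γ_i(y(t)) = t^{N d_i}` in `ℂ((t))`.
  On paper: Nullstellensatz (GMOW 2019 Prop. 3.3) + Newton–Puiseux. In the tree: GMOW Lemma 9.3 for
  monomial curves `Literature.Computability.AlgebraicComplexity.exists_aeval_eq_X_pow_of_not_isElusive`
  (PROVED) and the Puiseux parametrisation of finitely many algebraic functions
  `Summit.ValiantsHypothesis.Theorems.exists_laurent_relation_transfer` (PROVED, file
  `Theorems/BinomialElusiveNumericToPuiseux.lean`, whose `numericToPuiseux_proof` is the binomial twin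
  of this stub);
* `stub_swallowedInSmallSumset` (LOAD-BEARING, open; the route's cancellation crux in additive-cover
  form): whenever a quadratic map on `s` sources, `s^10 ≤ m^9`, formally swallows an injective exponent
  vector `D : Fin m → ℕ` (`Γ_i(y) = t^{D_i}`, `y ∈ ℂ((t))^s`), the exponent SET lies in a small sumset:
  `D ⊆ U + U` for some `U ⊂ ℤ` with `|U|^20 ≤ m^19` (`|U| ≤ m^{0.95}`). Honest (non-cancelling)
  coordinates give `D_i ∈ (V ∪ {0}) + (V ∪ {0})`, `V` = the `t`-orders of the `y_j` (`|V| ≤ s ≤ m^{0.9}`);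
  every swallower on record (toric, sparse, the pencil gadgets `y_a y_b − y_c y_d` over pools
  `t^w(1 + c t^p)`) is covered by `≤ (1 + #shifts)·s` values; the statement is the bet that cancellation
  cannot manufacture more than `m^{0.05}` "shift classes". It is STRONGER than the route's rank-3 crux
  `FormalSwallowForcesShortRelation` exactly by the next stub, and says something also for exponent
  vectors WITH relations (their cover number is small whenever they are swallowable);
* `stub_coveringGirth` (provable now, M; the girth engine): an injective `D ⊆ U + U` with
  `|U|^20 ≤ m^19`, `m ≥ m₀`, has a short alternating relation — multisets `S ≠ T` of indices of size
  `≤ 30` with `Σ_S D = Σ_T D` (covering graph on `U`, loops `≤ |U|`, dense core + Moore bound with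
  `k = 30`). In the tree this is Parts B + D of `Theorems/GirthSidonSparseSwallowForcesShortRelation.lean`:
  `GirthSidonSparse.exists_relation_core` and `GirthSidonSparse.exists_t_of_pow_le` (both PROVED; Part E
  there is the 40-line template, with `V := U`, `m₀ = 4098^25`).

The composition `MomentCurveElusive_of` is proved here (sorry-free): for `m ≥ max m₁ m₂ ⊔ 60` and
`s^10 ≤ m^9`, a swallower of the moment curve transfers to a formal swallowing of `D = N • d(m,·)`
(injective: `d(m,·)` is strictly increasing, `N ≥ 1`); the cover stub gives `U`; the girth stub gives
`S ≠ T` with `Σ_S N d = Σ_T N d`, hence `Σ_S d = Σ_T d`; the B₃₀ property of the power-sum code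
(`momentExponentsRelationFree_proof`, PROVED, item 6542) forces `S = T` — contradiction. The skeleton
theorem `MomentCurveElusive_proof : MomentCurveElusive` applies it to the three stubs.

Disproof used: none on file for this crux (`ledger crux ls stmt-ValiantsHypothesis-6534`: no workfiles,
no `Disproof.lean`, no Negative lemmas). Negatives index (`ledger negatives --problem ValiantsHypothesis`):
the only elusive-type entry is `Summit.ValiantsHypothesis.Elusive.ElusiveElusiveCandidate_refuted`
(item 0340: the Sidon monomial curve is NOT `(m−1,2)`-elusive — a TORIC swallower at `s = m − 1`,
outside the regime `s^10 ≤ m^9`, and covered by `U = V ∪ {0}`, `|U| ≤ s + 1`, so it is an instance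
of, not a witness against, `stub_swallowedInSmallSumset`).
-/

set_option linter.dupNamespace false

namespace Summit.ValiantsHypothesis.ValiantsHypothesis.Cruxes.MomentCurveElusive.Birth

open Summit.ValiantsHypothesis.ValiantsHypothesis.Theses.GirthSidon
open Literature.Computability.AlgebraicComplexity

/-! ## §1 The stub statements as named propositions

(The last name component of each `Sig.stub_*` is the registered stub's name, so that the composition
`MomentCurveElusive_of` takes the declared stubs BY NAME, `#h21_check_skeleton` (ii); the registered
`theorem stub_*` below spell the same statements out verbatim.) -/

namespace Sig

/-- **Stub 1** (numeric-to-Puiseux transfer for monomial curves). -/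
def stub_monomialNumericToPuiseux : Prop :=
    ∀ (m s : ℕ) (d : Fin m → ℕ),
      ¬ Literature.Computability.AlgebraicComplexity.IsElusive
          (fun i : Fin m => (MvPolynomial.X 0 : MvPolynomial (Fin 1) ℂ) ^ d i) s 2 →
      ∃ (N : ℕ) (Γ : Fin m → MvPolynomial (Fin s) ℂ) (y : Fin s → LaurentSeries ℂ),
        0 < N ∧ (∀ i, (Γ i).totalDegree ≤ 2) ∧
          ∀ i, MvPolynomial.aeval y (Γ i) = HahnSeries.single ((N * d i : ℕ) : ℤ) (1 : ℂ)

/-- **Stub 2** (formally swallowed exponent sets lie in a small sumset; load-bearing). -/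
def stub_swallowedInSmallSumset : Prop :=
    ∃ m₀ : ℕ, ∀ m ≥ m₀, ∀ (D : Fin m → ℕ) (s : ℕ), s ^ 10 ≤ m ^ 9 → Function.Injective D →
      ∀ (Γ : Fin m → MvPolynomial (Fin s) ℂ) (y : Fin s → LaurentSeries ℂ),
        (∀ i, (Γ i).totalDegree ≤ 2) →
        (∀ i, MvPolynomial.aeval y (Γ i) = HahnSeries.single (D i : ℤ) (1 : ℂ)) →
        ∃ U : Finset ℤ, U.card ^ 20 ≤ m ^ 19 ∧ ∀ i, ∃ a ∈ U, ∃ b ∈ U, (D i : ℤ) = a + b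

/-- **Stub 3** (covering girth: a small sumset cover of an injective exponent vector forces a short
alternating relation). -/
def stub_coveringGirth : Prop :=
    ∃ m₀ : ℕ, ∀ m ≥ m₀, ∀ (D : Fin m → ℕ), Function.Injective D →
      ∀ U : Finset ℤ, U.card ^ 20 ≤ m ^ 19 →
        (∀ i, ∃ a ∈ U, ∃ b ∈ U, (D i : ℤ) = a + b) →
        ∃ S T : Multiset (Fin m), S ≠ T ∧ Multiset.card S ≤ 30 ∧ Multiset.card T ≤ 30 ∧
          (S.map D).sum = (T.map D).sum

end Sig

/-! ## §2 The three registered stubs (statements spelled out; `sorry` lives only here) -/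

/-- **Stub 1 (numeric-to-Puiseux transfer for monomial curves).** If the monomial curve
`x ↦ (x^{d_i})_{i<m}` is not `(s,2)`-elusive over `ℂ` (its image lies in the image of a quadratic
`Γ : ℂ^s → ℂ^m`), then for some `N ≥ 1`, some quadratic `Γ` and Laurent series `y ∈ ℂ((t))^s`,
`Γ_i(y) = t^{N d_i}` for every `i`. Why plausibly true: it IS true — GMOW 2019 Lemma 9.3
(`exists_aeval_eq_X_pow_of_not_isElusive`, proved) gives `x^{d_i} = Γ_i(b(x))` over the algebraic
closure of `ℂ(x)`, and the Puiseux parametrisation `exists_laurent_relation_transfer` (proved, via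
`NewtonPuiseux_holds`) specialises every polynomial relation along `x ↦ t^N`, `b ↦ y(t)`; compare the
binomial twin `Summit.ValiantsHypothesis.Theorems.numericToPuiseux_proof`. [difficulty: S–M, provable now] -/
theorem stub_monomialNumericToPuiseux :
    ∀ (m s : ℕ) (d : Fin m → ℕ),
      ¬ Literature.Computability.AlgebraicComplexity.IsElusive
          (fun i : Fin m => (MvPolynomial.X 0 : MvPolynomial (Fin 1) ℂ) ^ d i) s 2 →
      ∃ (N : ℕ) (Γ : Fin m → MvPolynomial (Fin s) ℂ) (y : Fin s → LaurentSeries ℂ),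
        0 < N ∧ (∀ i, (Γ i).totalDegree ≤ 2) ∧
          ∀ i, MvPolynomial.aeval y (Γ i) = HahnSeries.single ((N * d i : ℕ) : ℤ) (1 : ℂ) :=
  -- CLOSED: landed as `Theorems/GirthSidonMomentCurveElusiveMonomialNumericToPuiseux.lean` (p147246)
  Summit.ValiantsHypothesis.ValiantsHypothesis.Theorems.stub_monomialNumericToPuiseux

/-- **Stub 2 (swallowed exponent sets lie in a small sumset; LOAD-BEARING, open).** For `m ≥ m₀`,
`s^10 ≤ m^9`, an injective `D : Fin m → ℕ`, a quadratic `Γ : ℂ^s → ℂ^m` and `y ∈ ℂ((t))^s` with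
`Γ_i(y) = t^{D_i}` for all `i`: there is `U ⊂ ℤ` with `|U|^20 ≤ m^19` and `D ⊆ U + U`.
Why plausibly true: honest coordinates (no cancellation of leading terms) have
`D_i ∈ (V ∪ {0}) + (V ∪ {0})`, `V` = `t`-orders of the `y_j`, `|V| ≤ s ≤ m^{0.9}`; toric and sparse
swallowers and the cancelling pencil gadgets are all covered by `≤ (1 + #shift classes)·s ≪ m^{0.95}`
values; exponent sets inside an interval of length `≤ m^{1.9}/8` are covered by a thin basis
regardless of the swallower. Why it might fail: dense high-degree pools `q_j(t)` with `≫ m^{0.05}·s`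
"2×2-determinant" monomial relations `q_a q_b − q_c q_d = c·t^{e}` with spread-out `e` would swallow a
set of large cover number (no such family is on record; GMOW §9, Narayanan 2026 §1.7).
[difficulty: open-problem] -/
theorem stub_swallowedInSmallSumset :
    ∃ m₀ : ℕ, ∀ m ≥ m₀, ∀ (D : Fin m → ℕ) (s : ℕ), s ^ 10 ≤ m ^ 9 → Function.Injective D →
      ∀ (Γ : Fin m → MvPolynomial (Fin s) ℂ) (y : Fin s → LaurentSeries ℂ),
        (∀ i, (Γ i).totalDegree ≤ 2) →
        (∀ i, MvPolynomial.aeval y (Γ i) = HahnSeries.single (D i : ℤ) (1 : ℂ)) →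
        ∃ U : Finset ℤ, U.card ^ 20 ≤ m ^ 19 ∧ ∀ i, ∃ a ∈ U, ∃ b ∈ U, (D i : ℤ) = a + b := by
  sorry

/-- **Stub 3 (covering girth).** For `m ≥ m₀` (`m₀ = 4098^25` works), an injective
`D : Fin m → ℕ` contained in `U + U` with `|U|^20 ≤ m^19` admits multisets `S ≠ T` of indices, each
of size `≤ 30`, with `Σ_S D = Σ_T D`. Why plausibly true: it IS true — write `D_i = u_i + v_i`
(`u_i, v_i ∈ U`); loops `u_i = v_i` are `≤ |U|` by injectivity; the `≥ m − |U|` proper edges on the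
vertex set `U` satisfy `2(t+30)|U| < #edges` and `|U| < t^30` for the `t` of
`GirthSidonSparse.exists_t_of_pow_le m |U|`, so `GirthSidonSparse.exists_relation_core`
(dense core + Moore count, `k = 30`) yields the relation; cast the `ℤ`-sums back to `ℕ`.
This is Part E of `Theorems/GirthSidonSparseSwallowForcesShortRelation.lean` with `V := U`.
[difficulty: M, provable now] -/
theorem stub_coveringGirth :
    ∃ m₀ : ℕ, ∀ m ≥ m₀, ∀ (D : Fin m → ℕ), Function.Injective D →
      ∀ U : Finset ℤ, U.card ^ 20 ≤ m ^ 19 →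
        (∀ i, ∃ a ∈ U, ∃ b ∈ U, (D i : ℤ) = a + b) →
        ∃ S T : Multiset (Fin m), S ≠ T ∧ Multiset.card S ≤ 30 ∧ Multiset.card T ≤ 30 ∧
          (S.map D).sum = (T.map D).sum :=
  -- CLOSED: landed as `Theorems/GirthSidonMomentCurveElusiveCoveringGirth.lean` (p146081)
  Summit.ValiantsHypothesis.ValiantsHypothesis.Theorems.stub_coveringGirth

/-! ## §3 Proved glue: the power-sum exponents are strictly increasing -/

/-- The moment exponents `d(m,i) = Σ_{k<60} (i+1)^k m^{60k}` are strictly increasing in `i`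
(for `m ≥ 1`; the `k = 1` digit already separates). [folklore] -/
theorem momentExponent_strictMono {m : ℕ} (hm : 1 ≤ m) {a b : ℕ} (hab : a < b) :
    (∑ k ∈ Finset.range 60, (a + 1) ^ k * m ^ (60 * k)) <
      ∑ k ∈ Finset.range 60, (b + 1) ^ k * m ^ (60 * k) := by
  apply Finset.sum_lt_sum
  · intro k _
    exact Nat.mul_le_mul_right _ (Nat.pow_le_pow_left (by omega) k)
  · refine ⟨1, by simp, ?_⟩
    have hpos : 0 < m ^ (60 * 1) := pow_pos (by omega) _
    simp only [pow_one]
    exact Nat.mul_lt_mul_of_pos_right (by omega) hpos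

/-- Injectivity of `i ↦ N · d(m,i)` on `Fin m` for `N ≥ 1`, `m ≥ 1`. [folklore] -/
theorem scaledMomentExponent_injective {m N : ℕ} (hm : 1 ≤ m) (hN : 0 < N) :
    Function.Injective
      (fun i : Fin m => N * ∑ k ∈ Finset.range 60, ((i : ℕ) + 1) ^ k * m ^ (60 * k)) := by
  intro i j hij
  have h := Nat.eq_of_mul_eq_mul_left hN hij
  by_contra hne
  rcases lt_or_gt_of_ne (fun h' : (i : ℕ) = j => hne (Fin.ext h')) with hlt | hgt
  · exact absurd h (momentExponent_strictMono hm hlt).ne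
  · exact absurd h (momentExponent_strictMono hm hgt).ne'

/-! ## §4 The kernel-checked composition -/

/-- **Assembly of the line.** `stub_monomialNumericToPuiseux → stub_swallowedInSmallSumset →
stub_coveringGirth → MomentCurveElusive`: for `m ≥ max m₁ m₂ ⊔ 60` and `s^10 ≤ m^9`, a quadratic
swallower of the moment curve transfers to a formal swallowing of `D = N • d(m,·)` (injective), the
cover stub gives `U`, the girth stub gives `S ≠ T` with `Σ_S N d = Σ_T N d`, hence `Σ_S d = Σ_T d`,
and the B₃₀ property of the power-sum code (`momentExponentsRelationFree_proof`, item 6542, PROVED)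
forces `S = T`. The conclusion is the route decl `GirthSidon.MomentCurveElusive` BY NAME. -/
theorem MomentCurveElusive_of :
    Sig.stub_monomialNumericToPuiseux → Sig.stub_swallowedInSmallSumset → Sig.stub_coveringGirth →
      MomentCurveElusive := by
  rintro hT ⟨m₁, hm₁⟩ ⟨m₂, hm₂⟩
  refine ⟨max (max m₁ m₂) 60, fun m hm s hs => ?_⟩
  have hm1 : m₁ ≤ m := le_trans (le_trans (le_max_left _ _) (le_max_left _ _)) hm
  have hm2 : m₂ ≤ m := le_trans (le_trans (le_max_right _ _) (le_max_left _ _)) hm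
  have h60 : 60 ≤ m := le_trans (le_max_right _ _) hm
  by_contra hne
  -- Stub 1: a formal swallowing of `t^{N d(m,i)}`
  obtain ⟨N, Γ, y, hN, hΓ, hy⟩ :=
    hT m s (fun i : Fin m => ∑ k ∈ Finset.range 60, ((i : ℕ) + 1) ^ k * m ^ (60 * k)) hne
  -- the scaled exponent vector is injective
  have hDinj : Function.Injective
      (fun i : Fin m => N * ∑ k ∈ Finset.range 60, ((i : ℕ) + 1) ^ k * m ^ (60 * k)) :=
    scaledMomentExponent_injective (by omega) hN
  -- Stub 2: a small sumset cover
  obtain ⟨U, hU, hcov⟩ :=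
    hm₁ m hm1 (fun i : Fin m => N * ∑ k ∈ Finset.range 60, ((i : ℕ) + 1) ^ k * m ^ (60 * k))
      s hs hDinj Γ y hΓ hy
  -- Stub 3: a short alternating relation among the scaled exponents
  obtain ⟨S, T, hST, hS, hT30, hsum⟩ :=
    hm₂ m hm2 (fun i : Fin m => N * ∑ k ∈ Finset.range 60, ((i : ℕ) + 1) ^ k * m ^ (60 * k))
      hDinj U hU hcov
  -- cancel `N`
  have hsum' : (S.map fun i : Fin m => ∑ k ∈ Finset.range 60, ((i : ℕ) + 1) ^ k * m ^ (60 * k)).sum =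
      (T.map fun i : Fin m => ∑ k ∈ Finset.range 60, ((i : ℕ) + 1) ^ k * m ^ (60 * k)).sum := by
    rw [Multiset.sum_map_mul_left, Multiset.sum_map_mul_left] at hsum
    exact Nat.eq_of_mul_eq_mul_left hN hsum
  -- the B₃₀ property of the power-sum code (item 6542, proved in the tree)
  exact hST (Summit.ValiantsHypothesis.ValiantsHypothesis.Theorems.momentExponentsRelationFree_proof
    m h60 S T hS hT30 hsum')

/-- **The skeleton**: `GirthSidon.MomentCurveElusive` BY NAME, modulo exactly the three registered
stubs (`sorry` occurs only inside `stub_monomialNumericToPuiseux`, `stub_swallowedInSmallSumset`,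
`stub_coveringGirth`). -/
theorem MomentCurveElusive_proof : MomentCurveElusive :=
  MomentCurveElusive_of stub_monomialNumericToPuiseux stub_swallowedInSmallSumset stub_coveringGirth

end Summit.ValiantsHypothesis.ValiantsHypothesis.Cruxes.MomentCurveElusive.Birth
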